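import Summits.MatrixMultiplication.MatrixMultiplication.Theorems.SubgroupIdentityDesigns.Negative.TorusBudget

/-!
# Weyl twins of the upper-cell laws (negative lemmas for the crux `SubgroupIdentityDesigns`,
# stmt-MatrixMultiplication-14079) — VALUE = THEOREM (all p), NOT summit progress; the crux stays
# open.

Conjugation by the Weyl element `w = [[0,1],[1,0]]` swaps `U⁺ ↔ U⁻`, upper ↔ lower triangular and
the two diagonal coordinates, and transports level-1 identity tests (`KernelLaw.idTest_map_conj`)
and the subgroup TPP.  Hence every upper-cell law with `U⁺ ≤ H₁` has a LOWER twin with `U⁻ ≤ H₁`: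

* `no_idTest_of_lower_rectangle` — `U⁻ ≤ H₁` and lower-triangular points of `H₁H₂H₃` with
  diagonals `(1,μ), (a,1), (a,μ)` (`a, μ ∉ {0,1}`) forbid a level-1 identity test;
* `torus_budget_lower` — subgroup TPP, `U⁻ ≤ H₁`, diagonal subgroups `D₁ ≤ H₁`, `D₂ ≤ H₂`, a
  LOWER-triangular subgroup `S ≤ H₃` and a level-1 identity test force `|D₁|·|D₂|·|S| ≤ p - 1`
  (crux vocabulary: `torus_budget_lower_levelOne`).

With `Reversal.design_reverse` (a test for `(H₁,H₂,H₃)` is one for `(H₃,H₂,H₁)`) these cover the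
placements with the unipotent radical in the LAST member, e.g. the frame `(U⁺T₁, S, U⁻T₂)`:
`|T₂| · |S ∩ T| · |T₁|`-type budgets on both Borels.
-/

set_option linter.dupNamespace false

noncomputable section

open scoped BigOperators Classical
open Summit.MatrixMultiplication.MatrixMultiplication.Theorems.LieRankDesigns.Negative
  (GLm Mat fourierFn)
open Summit.MatrixMultiplication.MatrixMultiplication.Theorems.LevelOneGL2Designs.Negative
  (levelSubmodule mem_levelSubmodule_iff fourierFn_mem_levelSubmodule levelSubmodule_bi_inv)

namespace Summit.MatrixMultiplication.MatrixMultiplication.Theorems.SubgroupIdentityDesigns.Negative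

section WeylTwin

open Literature.Barriers.MatrixMultiplication (SubgroupTPP)

variable {p : ℕ} [hp : Fact p.Prime]

/-- The Weyl element. -/
theorem exists_weyl : ∃ w : GLm p 2, (w : Mat p 2) = !![0, 1; 1, 0] :=
  ⟨Matrix.GeneralLinearGroup.mkOfDetNeZero _ (by rw [Matrix.det_fin_two_of]; simp), rfl⟩

/-- The Weyl element is an involution. -/
theorem weyl_inv {w : GLm p 2} (hw : (w : Mat p 2) = !![0, 1; 1, 0]) : w⁻¹ = w := by
  rw [inv_eq_iff_mul_eq_one]
  apply Units.ext
  rw [Units.val_mul, hw, Units.val_one]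
  ext i j
  fin_cases i <;> fin_cases j <;> simp [Matrix.mul_apply, Fin.sum_univ_two]

/-- The matrix of a Weyl conjugate: both indices are swapped. -/
theorem weyl_conj_coe {w : GLm p 2} (hw : (w : Mat p 2) = !![0, 1; 1, 0]) (x : GLm p 2) :
    ((w * x * w⁻¹ : GLm p 2) : Mat p 2) =
      !![(x : Mat p 2) 1 1, (x : Mat p 2) 1 0; (x : Mat p 2) 0 1, (x : Mat p 2) 0 0] := by
  rw [weyl_inv hw, Units.val_mul, Units.val_mul, hw]
  ext i j
  rw [Matrix.mul_apply, Fin.sum_univ_two, Matrix.mul_apply, Matrix.mul_apply, Fin.sum_univ_two,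
    Fin.sum_univ_two]
  fin_cases i <;> fin_cases j <;> simp

/-- Entries of a Weyl conjugate: the two indices are swapped. -/
theorem weyl_conj_entries {w : GLm p 2} (hw : (w : Mat p 2) = !![0, 1; 1, 0]) (x : GLm p 2) :
    ((w * x * w⁻¹ : GLm p 2) : Mat p 2) 0 0 = (x : Mat p 2) 1 1 ∧
    ((w * x * w⁻¹ : GLm p 2) : Mat p 2) 0 1 = (x : Mat p 2) 1 0 ∧
    ((w * x * w⁻¹ : GLm p 2) : Mat p 2) 1 0 = (x : Mat p 2) 0 1 ∧
    ((w * x * w⁻¹ : GLm p 2) : Mat p 2) 1 1 = (x : Mat p 2) 0 0 := by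
  rw [weyl_conj_coe hw]
  simp

/-- `U⁻ ≤ H` gives `U⁺ ≤ w⁻¹ H w`. -/
theorem upper_unitri_mem_conj {w : GLm p 2} (hw : (w : Mat p 2) = !![0, 1; 1, 0])
    {H : Subgroup (GLm p 2)}
    (hL : ∀ u : GLm p 2, (u : Mat p 2) 0 1 = 0 → (u : Mat p 2) 0 0 = 1 → (u : Mat p 2) 1 1 = 1 →
      u ∈ H) :
    ∀ u : GLm p 2, (u : Mat p 2) 1 0 = 0 → (u : Mat p 2) 0 0 = 1 → (u : Mat p 2) 1 1 = 1 →
      u ∈ H.map (MulAut.conj w⁻¹).toMonoidHom := by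
  intro u h10 h00 h11
  rw [mem_map_conj_inv_iff]
  obtain ⟨e00, e01, e10, e11⟩ := weyl_conj_entries hw u
  exact hL _ (by rw [e01, h10]) (by rw [e00, h11]) (by rw [e11, h00])

/-- Points of a conjugated triple product: a lower-triangular point `[[α,0],[y,β]]` of `H₁H₂H₃`
becomes the upper-triangular point `[[β,y],[0,α]]` of the `w`-conjugate triple. -/
theorem upper_point_of_lower_point {w : GLm p 2} (hw : (w : Mat p 2) = !![0, 1; 1, 0])
    {H₁ H₂ H₃ : Subgroup (GLm p 2)} {α β : ZMod p}
    (h : ∃ y : ZMod p, ∃ a ∈ H₁, ∃ b ∈ H₂, ∃ c ∈ H₃,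
      ((a * b * c : GLm p 2) : Mat p 2) = !![α, 0; y, β]) :
    ∃ y : ZMod p, ∃ a ∈ H₁.map (MulAut.conj w⁻¹).toMonoidHom,
      ∃ b ∈ H₂.map (MulAut.conj w⁻¹).toMonoidHom, ∃ c ∈ H₃.map (MulAut.conj w⁻¹).toMonoidHom,
      ((a * b * c : GLm p 2) : Mat p 2) = !![β, y; 0, α] := by
  obtain ⟨y, a, ha, b, hb, c, hc, habc⟩ := h
  refine ⟨y, w⁻¹ * a * w, ?_, w⁻¹ * b * w, ?_, w⁻¹ * c * w, ?_, ?_⟩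
  · rw [mem_map_conj_inv_iff]; simpa [mul_assoc] using ha
  · rw [mem_map_conj_inv_iff]; simpa [mul_assoc] using hb
  · rw [mem_map_conj_inv_iff]; simpa [mul_assoc] using hc
  have hprod : w⁻¹ * a * w * (w⁻¹ * b * w) * (w⁻¹ * c * w) = w⁻¹ * (a * b * c) * w := by
    group
  have hprod' : w⁻¹ * (a * b * c) * w = w * (a * b * c) * w⁻¹ := by rw [weyl_inv hw]
  rw [hprod, hprod', weyl_conj_coe hw, habc]
  ext i j
  fin_cases i <;> fin_cases j <;> simp

/-- **LOWER RECTANGLE LAW** (Weyl twin of `no_idTest_of_upper_rectangle`). -/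
theorem no_idTest_of_lower_rectangle {H₁ H₂ H₃ : Subgroup (GLm p 2)}
    (hL : ∀ u : GLm p 2, (u : Mat p 2) 0 1 = 0 → (u : Mat p 2) 0 0 = 1 → (u : Mat p 2) 1 1 = 1 →
      u ∈ H₁)
    {a μ : ZMod p} (ha0 : a ≠ 0) (ha1 : a ≠ 1) (hμ0 : μ ≠ 0) (hμ1 : μ ≠ 1)
    (h1μ : ∃ y : ZMod p, ∃ a' ∈ H₁, ∃ b ∈ H₂, ∃ c ∈ H₃,
      ((a' * b * c : GLm p 2) : Mat p 2) = !![1, 0; y, μ])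
    (ha1' : ∃ y : ZMod p, ∃ a' ∈ H₁, ∃ b ∈ H₂, ∃ c ∈ H₃,
      ((a' * b * c : GLm p 2) : Mat p 2) = !![a, 0; y, 1])
    (haμ : ∃ y : ZMod p, ∃ a' ∈ H₁, ∃ b ∈ H₂, ∃ c ∈ H₃,
      ((a' * b * c : GLm p 2) : Mat p 2) = !![a, 0; y, μ]) :
    ¬ ∃ f ∈ levelSubmodule p 2 1, f 1 = 1 ∧
        ∀ a' ∈ H₁, ∀ b ∈ H₂, ∀ c ∈ H₃, a' * b * c ≠ 1 → f (a' * b * c) = 0 := by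
  intro hdesign
  obtain ⟨w, hw⟩ := exists_weyl (p := p)
  exact no_idTest_of_upper_rectangle (upper_unitri_mem_conj hw hL) hμ0 hμ1 ha0 ha1
    (upper_point_of_lower_point hw ha1') (upper_point_of_lower_point hw h1μ)
    (upper_point_of_lower_point hw haμ) (idTest_map_conj w hdesign)

omit hp in
/-- Cardinality is preserved under conjugation of subgroups. -/
theorem card_map_conj (D : Subgroup (GLm p 2)) (c : GLm p 2) :
    Nat.card (D.map (MulAut.conj c⁻¹).toMonoidHom) = Nat.card D :=
  (Nat.card_congr (Subgroup.equivMapOfInjective D _ (MulAut.conj c⁻¹).injective).toEquiv).symm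

/-- **TORUS BUDGET, lower twin.**  Subgroup TPP with `U⁻ ≤ H₁`, diagonal subgroups `D₁ ≤ H₁`,
`D₂ ≤ H₂`, a lower-triangular subgroup `S ≤ H₃` and a level-1 identity test force
`|D₁|·|D₂|·|S| ≤ p - 1`. -/
theorem torus_budget_lower {H₁ H₂ H₃ : Subgroup (GLm p 2)} (htpp : SubgroupTPP H₁ H₂ H₃)
    (hL : ∀ u : GLm p 2, (u : Mat p 2) 0 1 = 0 → (u : Mat p 2) 0 0 = 1 → (u : Mat p 2) 1 1 = 1 →
      u ∈ H₁)
    {D₁ D₂ S : Subgroup (GLm p 2)} (hD₁ : D₁ ≤ H₁) (hD₂ : D₂ ≤ H₂) (hS : S ≤ H₃)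
    (hd₁ : ∀ d ∈ D₁, (d : Mat p 2) 0 1 = 0 ∧ (d : Mat p 2) 1 0 = 0)
    (hd₂ : ∀ d ∈ D₂, (d : Mat p 2) 0 1 = 0 ∧ (d : Mat p 2) 1 0 = 0)
    (hs : ∀ s ∈ S, (s : Mat p 2) 0 1 = 0)
    (hdesign : ∃ f ∈ levelSubmodule p 2 1, f 1 = 1 ∧
      ∀ a ∈ H₁, ∀ b ∈ H₂, ∀ c ∈ H₃, a * b * c ≠ 1 → f (a * b * c) = 0) :
    Nat.card D₁ * Nat.card D₂ * Nat.card S ≤ p - 1 := by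
  obtain ⟨w, hw⟩ := exists_weyl (p := p)
  have htpp' : SubgroupTPP (H₁.map (MulAut.conj w⁻¹).toMonoidHom)
      (H₂.map (MulAut.conj w⁻¹).toMonoidHom) (H₃.map (MulAut.conj w⁻¹).toMonoidHom) :=
    subgroupTPP_map_of_injective _ (MulAut.conj w⁻¹).injective htpp
  have hdiag : ∀ {D : Subgroup (GLm p 2)},
      (∀ d ∈ D, (d : Mat p 2) 0 1 = 0 ∧ (d : Mat p 2) 1 0 = 0) →
      ∀ d ∈ D.map (MulAut.conj w⁻¹).toMonoidHom, (d : Mat p 2) 0 1 = 0 ∧ (d : Mat p 2) 1 0 = 0 := by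
    intro D hD d hd
    rw [mem_map_conj_inv_iff] at hd
    obtain ⟨e00, e01, e10, e11⟩ := weyl_conj_entries hw d
    exact ⟨by rw [← e10]; exact (hD _ hd).2, by rw [← e01]; exact (hD _ hd).1⟩
  have hs' : ∀ s ∈ S.map (MulAut.conj w⁻¹).toMonoidHom, (s : Mat p 2) 1 0 = 0 := by
    intro s hs1
    rw [mem_map_conj_inv_iff] at hs1
    obtain ⟨-, e01, -, -⟩ := weyl_conj_entries hw s
    rw [← e01]; exact hs _ hs1
  have h := torus_budget htpp' (upper_unitri_mem_conj hw hL) (Subgroup.map_mono hD₁)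
    (Subgroup.map_mono hD₂) (Subgroup.map_mono hS) (hdiag hd₁) (hdiag hd₂) hs'
    (idTest_map_conj w hdesign)
  rwa [card_map_conj, card_map_conj, card_map_conj] at h

/-- **TORUS BUDGET, lower twin** in the crux's vocabulary. -/
theorem torus_budget_lower_levelOne {H₁ H₂ H₃ : Subgroup (GLm p 2)}
    (htpp : SubgroupTPP H₁ H₂ H₃)
    (hL : ∀ u : GLm p 2, (u : Mat p 2) 0 1 = 0 → (u : Mat p 2) 0 0 = 1 → (u : Mat p 2) 1 1 = 1 →
      u ∈ H₁)
    {D₁ D₂ S : Subgroup (GLm p 2)} (hD₁ : D₁ ≤ H₁) (hD₂ : D₂ ≤ H₂) (hS : S ≤ H₃)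
    (hd₁ : ∀ d ∈ D₁, (d : Mat p 2) 0 1 = 0 ∧ (d : Mat p 2) 1 0 = 0)
    (hd₂ : ∀ d ∈ D₂, (d : Mat p 2) 0 1 = 0 ∧ (d : Mat p 2) 1 0 = 0)
    (hs : ∀ s ∈ S, (s : Mat p 2) 0 1 = 0)
    (hdesign : ∃ c : Mat p 2 → ℂ, (∀ M, 1 < M.rank → c M = 0) ∧
      (∑ M, c M * ZMod.stdAddChar (Matrix.trace (M * ((1 : GLm p 2) : Mat p 2)))) = 1 ∧
      ∀ a ∈ H₁, ∀ b ∈ H₂, ∀ g ∈ H₃, a * b * g ≠ 1 →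
        (∑ M, c M *
          ZMod.stdAddChar (Matrix.trace (M * ((a * b * g : GLm p 2) : Mat p 2)))) = 0) :
    Nat.card D₁ * Nat.card D₂ * Nat.card S ≤ p - 1 := by
  obtain ⟨c, hc, hc1, hc0⟩ := hdesign
  exact torus_budget_lower htpp hL hD₁ hD₂ hS hd₁ hd₂ hs
    ⟨fourierFn c, fourierFn_mem_levelSubmodule hc, hc1, fun a ha b hb g hg hne =>
      hc0 a ha b hb g hg hne⟩

end WeylTwin

end Summit.MatrixMultiplication.MatrixMultiplication.Theorems.SubgroupIdentityDesigns.Negative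

end
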